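import Mathlib.LinearAlgebra.Dimension.Finrank
import Literature.Barriers.Schanuel.EFunctionValuesAtAlgebraicPoints
import HarnessLib

/-!
# The Shidlovskii rank theorem (Rivoal Thm. 5.20) — the analytic engine of Siegel–Shidlovskii, as a named fact

`Literature/Barriers/Schanuel/SiegelShidlovskiiRank.lean` — second file of the programme
"prove `siegelShidlovskii_algIndep`" (`Literature/Barriers/Schanuel/EFunctionValuesAtAlgebraicPoints.lean`,
Rivoal Thm. 5.10). The printed proof of Thm. 5.10 (Rivoal §5.3, pp. 237–241, "On suit la trame
proposée par Baker [13, Chap. 11]") has exactly one analytic output, the RANK bound of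
Théorème 5.20 (Siegel's lemma 5.13, the Padé-type approximants of Proposition 5.14,
Shidlovskii's Lemme 5.15, Lemme 5.16 and Proposition 5.17 all feed into it), after which
"Ce dernier énoncé suffit toutefois pour démontrer ce que l'on veut grâce à l'astuce de Siegel …
Après un travail assez technique, on ramène alors la démonstration du théorème 5.10 à une
application du théorème 5.20" (pp. 240–241) — pure algebra, proved in the sibling reduction
files. This file vendors Théorème 5.20 as the named fact `shidlovskii_rankBound`, the single
remaining analytic input of `siegelShidlovskii_algIndep`; its own decomposition (5.13–5.17 over a
number field) is the next layer of the programme.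

## What the source prints (verified on the page) [Rivoal2024]

* Théorème 5.20 (p. 240): "Soit `K = ℚ(β)` un corps de nombres. Soit
  `Y(z) = ᵗ(F₁(z), …, Fₙ(z))` un vecteur de `E`-fonctions de `K[[z]]` solution d'un système
  différentiel `Y′(z) = A(z)Y(z)` avec `A(z) ∈ M_{n×n}(K(z))`. Supposons que les fonctions
  `F₁(z), …, Fₙ(z)` soient linéairement indépendantes sur `K(z)`. Alors pour tout `α ∈ K` tel que
  `αT(α) ≠ 0`, le rang sur `K` de la famille `(F₁(α), …, Fₙ(α))` est `≥ n/[K : ℚ]`. Si de plus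
  `β ∉ ℝ`, alors ce rang est `≥ 2n/[K : ℚ]`." — "Voir [157, p. 115, Lem. 17]" (Shidlovskii,
  *Transcendental numbers*, de Gruyter 1989). Here `T(z)` is, as in Théorème 5.10, "un
  dénominateur commun des coefficients de `A(z)`, de degré minimal" (p. 234).
* Footnote 11 (p. 240): "L'énoncé optimal (i.e., où le rang vaut `n` exactement) a été obtenu en
  2006 par Beukers [23] pour les `E`-fonctions au sens strict, et par André [10] en 2014 pour les
  `E`-fonctions au sens large." In particular the first bound of Théorème 5.20 holds.

## Lean rendering (`shidlovskii_rankBound`)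

* `K` is a subfield of `ℂ` finite-dimensional over `ℚ` (`K : IntermediateField ℚ ℂ`,
  `FiniteDimensional ℚ K`; every number field `ℚ(β) ⊂ ℂ` is one and conversely, by the
  primitive element theorem); the vector `Y` is a finite family indexed by a `Fintype ι`
  (`n = Fintype.card ι`).
* "`E`-fonctions de `K[[z]]`": strict `E`-functions in the sense of `IsStrictEFunction`
  (Définition 5.2; the printed theorem is for `E`-functions in the large sense, which contain
  the strict ones) whose coefficients `aₙ` (equivalently `aₙ/n!`) lie in `K`.
* "`Y′ = AY`, `A ∈ M_n(K(z))`, `αT(α) ≠ 0`": `T(z) Fᵢ′(z) = ∑ⱼ Bᵢⱼ(z) Fⱼ(z)` for polynomials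
  `T`, `Bᵢⱼ` with coefficients in `K`, and `T(α) ≠ 0` for THIS `T`; the minimal common
  denominator of `A = B/T` divides any such `T`, so this hypothesis implies the printed one.
* "linéairement indépendantes sur `K(z)`" ⟺ over `K[z]` (clear denominators): every family of
  polynomials `cᵢ ∈ K[z]` with `∑ cᵢ(z)Fᵢ(z) ≡ 0` vanishes.
* "le rang sur `K` de la famille `(F₁(α), …, Fₙ(α))` est `≥ n/[K:ℚ]`":
  `n ≤ [K:ℚ] · dim_K span_K {Fᵢ(α)}` with Mathlib's `Module.finrank` of the `K`-submodule of
  `ℂ` spanned by the values (an exact restatement, no rounding).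
Only the first (unconditional) bound is vendored.

## References

* [Rivoal2024] T. Rivoal, *Les E-fonctions et G-fonctions de Siegel*, Journées X-UPS 2019
  (2024), doi:10.5802/xups.2019-03: Théorème 5.20 and footnote 11 (p. 240), Théorème 5.10
  (p. 234), §5.3 pp. 237–241.
* A. B. Shidlovskii, *Transcendental numbers*, de Gruyter Studies in Math. 12 (1989), Ch. 3,
  Lemma 17 (p. 115); F. Beukers, Ann. of Math. 163 (2006) — cited through [Rivoal2024].
-/

noncomputable section

open Complex Polynomial
open scoped Nat

namespace Literature.Barriers.Schanuel

-- The `ℚ`-algebra diamond on subfields of `ℂ` (`DivisionRing.toRatAlgebra` vs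
-- `IntermediateField.algebra`): as in `EFunctionSeries.lean` / `PeriodConjectureOverQbarScope.lean`,
-- elaborate with the latter only; the remaining `Algebra ℚ ℂ` instance is definitionally the
-- removed one, so the statement agrees with the other files of the programme.
attribute [-instance] DivisionRing.toRatAlgebra

/-- **Shidlovskii's rank theorem (Rivoal Thm. 5.20, first bound)** — named fact. Let `K ⊂ ℂ` be a
number field (`[K:ℚ] < ∞`) and `(Fᵢ)_{i ∈ ι}`, `Fᵢ = ∑ₙ aᵢ,ₙ zⁿ/n!`, a finite family of strict
`E`-functions with all coefficients `aᵢ,ₙ ∈ K`, solution of a differential system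
`T(z) Fᵢ′(z) = ∑ⱼ Bᵢⱼ(z) Fⱼ(z)` with `T, Bᵢⱼ ∈ K[z]` (i.e. `Y′ = AY`, `A = B/T ∈ M_ι(K(z))`),
and linearly independent over `K(z)` (equivalently over `K[z]`: no non-trivial relation
`∑ cᵢ(z) Fᵢ(z) ≡ 0` with `cᵢ ∈ K[z]`). Then for every `α ∈ K` with `α ≠ 0` and `T(α) ≠ 0`
(which implies `αT₀(α) ≠ 0` for the minimal common denominator `T₀ ∣ T` of `A`), the rank over
`K` of the family of values `(Fᵢ(α))ᵢ` is at least `#ι/[K:ℚ]`: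
`#ι ≤ [K:ℚ] · dim_K span_K {Fᵢ(α) : i ∈ ι}`. (The printed refinement `≥ 2n/[K:ℚ]` for `K = ℚ(β)`,
`β ∉ ℝ`, is not vendored; the optimal statement "rank `= n`" is Beukers 2006 / André 2014,
footnote 11.) Users take `(h : shidlovskii_rankBound)`.
[cite: Rivoal2024, Théorème 5.20] -/
def shidlovskii_rankBound : Prop :=
  ∀ (K : IntermediateField ℚ ℂ) [FiniteDimensional ℚ K] (ι : Type) [Fintype ι] [DecidableEq ι]
    (a : ι → ℕ → ℂ), (∀ i, IsStrictEFunction (a i)) → (∀ i n, a i n ∈ K) →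
    ∀ (T : Polynomial ℂ) (B : Matrix ι ι (Polynomial ℂ)),
      (∀ k, T.coeff k ∈ K) → (∀ i j k, (B i j).coeff k ∈ K) →
      (∀ i z, T.eval z * deriv (eSeries (a i)) z = ∑ j, (B i j).eval z * eSeries (a j) z) →
      (∀ c : ι → Polynomial ℂ, (∀ i k, (c i).coeff k ∈ K) →
        (∀ z, ∑ i, (c i).eval z * eSeries (a i) z = 0) → c = 0) →
      ∀ α : ℂ, α ∈ K → α ≠ 0 → T.eval α ≠ 0 →
        Fintype.card ι ≤ Module.finrank ℚ K *
          Module.finrank K (Submodule.span K (Set.range fun i => eSeries (a i) α))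

/-- Unfolding lemma for `shidlovskii_rankBound` in the `Fin n`-indexed form of Théorème 5.20
(`Y = ᵗ(F₁, …, Fₙ)`): `n ≤ [K:ℚ] · rank_K (F₁(α), …, Fₙ(α))`. [cite: Rivoal2024, Théorème 5.20] -/
theorem shidlovskii_rankBound.fin (h : shidlovskii_rankBound) (K : IntermediateField ℚ ℂ)
    [FiniteDimensional ℚ K] (n : ℕ) (a : Fin n → ℕ → ℂ) (ha : ∀ i, IsStrictEFunction (a i))
    (haK : ∀ i k, a i k ∈ K) (T : Polynomial ℂ) (B : Matrix (Fin n) (Fin n) (Polynomial ℂ))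
    (hT : ∀ k, T.coeff k ∈ K) (hB : ∀ i j k, (B i j).coeff k ∈ K)
    (hsys : ∀ i z, T.eval z * deriv (eSeries (a i)) z = ∑ j, (B i j).eval z * eSeries (a j) z)
    (hli : ∀ c : Fin n → Polynomial ℂ, (∀ i k, (c i).coeff k ∈ K) →
      (∀ z, ∑ i, (c i).eval z * eSeries (a i) z = 0) → c = 0)
    (α : ℂ) (hαK : α ∈ K) (hα : α ≠ 0) (hTα : T.eval α ≠ 0) :
    n ≤ Module.finrank ℚ K *
      Module.finrank K (Submodule.span K (Set.range fun i => eSeries (a i) α)) := by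
  simpa using h K (Fin n) a ha haK T B hT hB hsys hli α hαK hα hTα

end Literature.Barriers.Schanuel

end
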